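import Summits.BirchSwinnertonDyer.BirchSwinnertonDyer.Theses.CountingDoorF2AtThree
import Literature.NumberTheory.EllipticCurves.IwasawaLeadingTermOddPrime
import Literature.NumberTheory.EllipticCurves.IwasawaLeadingTermProofs
import Literature.NumberTheory.EllipticCurves.BSDSelmerPConverseSerreProofs
import Literature.NumberTheory.EllipticCurves.SemistableModPImageFiveProofs
import HarnessLib

/-!
# BirchSwinnertonDyer / CountingDoorF2AtThree — the λ-door KERNEL, per member, at an odd good ordinary prime
# (helper for crux I4 `SchneiderDensityOneAtThree`, stmt-BirchSwinnertonDyer-19442, whose docstring names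
# the one-directional λ-certificate; and for the sibling λ-door at a NON-ANOMALOUS prime, cell memo
# `HOME/bsd-rank2-eng/data/f2door/LAMBDA5.md`)

Route `route-BirchSwinnertonDyer-CountingDoorF2AtThree` (cell bsd-rank2). Let `E/ℚ` have globally
minimal model `W`, `p` an ODD prime of good ordinary reduction, `X = X(E/ℚ_∞)` the cyclotomic Selmer
dual with `char_Λ X = (f_E)`, `r ≤ rank E(ℚ)`, and suppose the `T^r`-coefficient of `f_E` is a
`p`-adic UNIT ("`μ(f_E) = 0` and `λ(f_E) ≤ r`" in the form in which it is used). Modulo the single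
named fact `Schneider1985_order_charGenerator_odd` (Perrin-Riou / Schneider 1985, as printed in
Balakrishnan–Müller–Stein Thm. 1.7, `p > 2`):

* `rank_eq_and_schneider_of_isUnit_coeff` (A): `rank E(ℚ) = r`, `ord_{T=0} f_E = r`, Schneider's
  conjecture holds for every canonical `p`-adic height datum and `Ш(E)[p^∞]` is finite — clause 1
  (`rank ≤ ord f_E`) and `ord f_E ≤ r` (a unit coefficient is non-zero) squeeze, then clause 2.
  At `p = 3` this is the "member-wise certificate (one direction only)" recorded in the docstring of
  crux I4: `μ₃ = 0 ∧ λ₃ = 2 ⟹ ord_T = rank = 2 ⟹ Schneider at 3`.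
* `sha_eq_bot_of_isUnit_coeff` (B): if moreover `p ∤ #Ẽ(𝔽_p)` (non-anomalous), `p ∤ #E(ℚ)_tors`
  and the canonical regulator is INTEGRAL in the sense `‖Reg_p(E, Dh)‖ ≤ p^{-rank}` (every entry of
  the canonical cyclotomic Gram matrix lies in `pℤ_p`: Mazur–Tate 1983 §3.3 off the anomalous and
  `p ∣ c_ℓ` regimes; checked on 18 756/18 756 + 26 409/26 409 members of the family `F₂` at
  `p = 5, 7`, LAMBDA5.md §1), then clause 3 (the leading-term valuation
  `[T^r]f_E · log_p(γ)^r · #tors² = u · (1 − α⁻¹)² · #Ш[p^∞] · Reg_p · ∏ c_ℓ`) read in norms —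
  `‖log_p γ‖ = p⁻¹` (`exists_unit_padicLog_cyclotomicGenerator`), `‖1 − α⁻¹‖ = ‖#Ẽ(𝔽_p)‖ = 1`
  (`exists_unit_one_sub_unitRoot_inv`) — forces `‖#Ш[p^∞]‖ = ‖∏ c_ℓ‖ = 1` and `‖Reg_p‖ = p^{-r}`;
  a finite `p`-primary group of order prime to `p` is trivial, so `Ш(E)[p^∞] = 0`.

Nothing here is family-wise; the passage from PARI's ANALYTIC `λ_p(L_p) = r` to the hypothesis on
`f_E` needs Kato's divisibility (integral form) and is not made here. PARTITION: none — r_an ≥ 2,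
summit axis S0; TWIN (D-0056): n/a. B1 honesty: per-member kernel modulo a published fact; no
analytic rank is mentioned.
-/

set_option linter.dupNamespace false

noncomputable section

open scoped Classical

namespace Summit.BirchSwinnertonDyer.BirchSwinnertonDyer.Theorems

open Literature.NumberTheory.EllipticCurves WeierstrassCurve

variable {W : WeierstrassCurve ℚ} [W.IsElliptic] [W.IsGloballyMinimal] {p : ℕ} [hp : Fact p.Prime]

/-- A finite `p`-primary component whose order is prime to `p` is trivial. [folklore] -/
theorem primaryComponent_eq_bot_of_not_dvd_card {A : Type*} [AddCommGroup A]
    [Finite (AddCommGroup.primaryComponent A p)]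
    (h : ¬ p ∣ Nat.card (AddCommGroup.primaryComponent A p)) :
    AddCommGroup.primaryComponent A p = ⊥ := by
  refine (AddSubgroup.eq_bot_iff_forall _).mpr fun y hy ↦ ?_
  obtain ⟨n, hn⟩ := (AddCommGroup.mem_primaryComponent_iff_addOrderOf (p := p)).mp hy
  have hdvd : addOrderOf (⟨y, hy⟩ : AddCommGroup.primaryComponent A p) ∣
      Nat.card (AddCommGroup.primaryComponent A p) := addOrderOf_dvd_natCard _
  rw [AddSubgroup.addOrderOf_mk, hn] at hdvd
  rcases n with _ | n
  · rw [pow_zero] at hn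
    exact AddMonoid.addOrderOf_eq_one_iff.mp hn
  · exact absurd (dvd_trans (dvd_pow_self p (Nat.succ_ne_zero n)) hdvd) h

/-- **(A) The λ-certificate, per member, at an odd good ordinary prime** (modulo
`Schneider1985_order_charGenerator_odd`): if `r ≤ rank E(ℚ)` and the `T^r`-coefficient of the
characteristic power series `f_E` of `X(E/ℚ_∞)` is a unit of `ℤ_p`, then `rank E(ℚ) = r`,
`ord_{T=0} f_E = r`, and for every CANONICAL `p`-adic height datum Schneider's conjecture holds and
`Ш(E)[p^∞]` is finite (BMS Thm. 1.7 clauses 1–2: `rank ≤ ord f_E ≤ r ≤ rank`).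
[cite: BalakrishnanMullerStein2015, Thm. 1.7] [cite: Schneider1985, Thm. 2′ p. 342] -/
theorem rank_eq_and_schneider_of_isUnit_coeff (h85 : Schneider1985_order_charGenerator_odd)
    (hp2 : p ≠ 2) (hgood : W.HasGoodReductionAtPrime p) (hord : ¬ (p : ℤ) ∣ W.frobeniusTrace p)
    {κ : ZpExtension ℚ p} {γ : Field.absoluteGaloisGroup ℚ}
    (hκ : κ.IsCyclotomic) (hγ : κ.IsTopGenerator γ) (hγ' : IsCyclotomicVariable p γ)
    (D : W.SelmerDualData κ γ) [Module.Finite (IwasawaAlgebra p) D.X] (hX : D.IsTorsion)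
    {fE : IwasawaAlgebra p} (hf : D.charIdeal = Ideal.span {fE})
    {r : ℕ} (hr : r ≤ W.mordellWeilRank) (hu : IsUnit (PowerSeries.coeff r fE))
    (Dh : PAdicHeightData W p) (hDh : Dh.IsCanonical) :
    W.mordellWeilRank = r ∧ fE.order = r ∧ SchneiderConjecture Dh ∧
      Finite (AddCommGroup.primaryComponent W.sha p) := by
  obtain ⟨hle, hiff, -⟩ := h85 W p hp2 hgood hord κ γ hκ hγ hγ' D hX fE hf Dh hDh
  have hne : PowerSeries.coeff r fE ≠ 0 := hu.ne_zero
  have hord_le : fE.order ≤ r := PowerSeries.order_le r hne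
  have h1 : (W.mordellWeilRank : ℕ∞) ≤ r := hle.trans hord_le
  have hrank : W.mordellWeilRank = r := le_antisymm (by exact_mod_cast h1) hr
  have horder : fE.order = r := by
    refine le_antisymm hord_le ?_
    calc (r : ℕ∞) ≤ W.mordellWeilRank := by exact_mod_cast hr
      _ ≤ fE.order := hle
  have heq : fE.order = W.mordellWeilRank := by rw [horder, hrank]
  obtain ⟨hS, hfin⟩ := hiff.mp heq
  exact ⟨hrank, horder, hS, hfin⟩

/-- **(B) The λ-door at a NON-ANOMALOUS prime pins `Ш[p^∞] = 0`** (modulo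
`Schneider1985_order_charGenerator_odd`). In the situation of (A) assume moreover `p ∤ #Ẽ(𝔽_p)`,
`p ∤ #E(ℚ)_tors`, and that the canonical regulator is integral, `‖Reg_p(E, Dh)‖ ≤ p^{-rank E(ℚ)}`
(all canonical Gram entries in `pℤ_p` — Mazur–Tate 1983 §3.3 away from the anomalous and `p ∣ c_ℓ`
regimes). Then the leading-term clause 3, read in `p`-adic norms with `‖log_p γ_cyc‖ = p⁻¹` and
`‖1 − α⁻¹‖ = ‖#Ẽ(𝔽_p)‖ = 1`, gives `‖#Ш[p^∞]‖ · ‖Reg_p‖ · ‖∏ c_ℓ‖ = p^{-r}` with each factor at its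
ceiling, whence `Ш(E)[p^∞] = 0`, `p ∤ ∏ c_ℓ` and `‖Reg_p‖ = p^{-r}`.
[cite: BalakrishnanMullerStein2015, Thm. 1.7 and the remark following it (ord_p ε_p = 2 ord_p N_p)]
[cite: MazurTate1983Biext, §3.3 (values of the canonical pairing)] -/
theorem sha_eq_bot_of_isUnit_coeff (h85 : Schneider1985_order_charGenerator_odd)
    (hp2 : p ≠ 2) (hgood : W.HasGoodReductionAtPrime p) (hord : ¬ (p : ℤ) ∣ W.frobeniusTrace p)
    {κ : ZpExtension ℚ p} {γ : Field.absoluteGaloisGroup ℚ}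
    (hκ : κ.IsCyclotomic) (hγ : κ.IsTopGenerator γ) (hγ' : IsCyclotomicVariable p γ)
    (D : W.SelmerDualData κ γ) [Module.Finite (IwasawaAlgebra p) D.X] (hX : D.IsTorsion)
    {fE : IwasawaAlgebra p} (hf : D.charIdeal = Ideal.span {fE})
    {r : ℕ} (hr : r ≤ W.mordellWeilRank) (hu : IsUnit (PowerSeries.coeff r fE))
    (Dh : PAdicHeightData W p) (hDh : Dh.IsCanonical)
    (hna : ¬ p ∣ W.reductionPointCount p) (htors : ¬ p ∣ W.torsionOrder)
    (hint : ‖padicRegulator Dh‖ ≤ ((p : ℝ)⁻¹) ^ W.mordellWeilRank) :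
    W.mordellWeilRank = r ∧ fE.order = r ∧ SchneiderConjecture Dh ∧
      AddCommGroup.primaryComponent W.sha p = ⊥ ∧ ¬ p ∣ W.tamagawaProduct ∧
      ‖padicRegulator Dh‖ = ((p : ℝ)⁻¹) ^ r := by
  obtain ⟨hrank, horder, hS, hfin⟩ :=
    rank_eq_and_schneider_of_isUnit_coeff h85 hp2 hgood hord hκ hγ hγ' D hX hf hr hu Dh hDh
  obtain ⟨-, -, hlead⟩ := h85 W p hp2 hgood hord κ γ hκ hγ hγ' D hX fE hf Dh hDh
  obtain ⟨u, hu3⟩ := hlead hS hfin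
  haveI := hfin
  -- the units of the tree: `log_p γ = p · u₁`, `1 - α⁻¹ = u₂ · #Ẽ(𝔽_p)`
  obtain ⟨u₁, hu₁⟩ := exists_unit_padicLog_cyclotomicGenerator p hp2
  obtain ⟨u₂, hu₂⟩ := exists_unit_one_sub_unitRoot_inv p W ⟨hgood, hord⟩
  -- norms of the individual factors
  have hnU : ∀ v : ℤ_[p]ˣ, ‖((v : ℤ_[p]) : ℚ_[p])‖ = 1 := fun v ↦ by
    rw [PadicInt.padic_norm_e_of_padicInt]; exact PadicInt.isUnit_iff.mp v.isUnit
  have hp0 : (0 : ℝ) < (p : ℝ)⁻¹ := inv_pos.mpr (by exact_mod_cast hp.out.pos)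
  have hcoeff : ‖((PowerSeries.coeff r fE : ℤ_[p]) : ℚ_[p])‖ = 1 := by
    rw [PadicInt.padic_norm_e_of_padicInt]; exact PadicInt.isUnit_iff.mp hu
  have hlog : ‖padicLog p (cyclotomicGenerator p : ℚ_[p])‖ = (p : ℝ)⁻¹ := by
    rw [hu₁, norm_mul, hnU, mul_one, Padic.norm_p]
  have htor : ‖(W.torsionOrder : ℚ_[p])‖ = 1 :=
    Padic.norm_natCast_eq_one_iff.mpr ((Nat.Prime.coprime_iff_not_dvd hp.out).mpr htors)
  have hNp : ‖(W.reductionPointCount p : ℚ_[p])‖ = 1 :=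
    Padic.norm_natCast_eq_one_iff.mpr ((Nat.Prime.coprime_iff_not_dvd hp.out).mpr hna)
  have heps : ‖(1 - ((unitRoot W p : ℤ_[p]) : ℚ_[p])⁻¹)‖ = 1 := by
    rw [hu₂, norm_mul, hnU, hNp, one_mul]
  -- abbreviations for the three unknown norms and the target value
  set a : ℝ := ‖(Nat.card (AddCommGroup.primaryComponent W.sha p) : ℚ_[p])‖ with ha
  set b : ℝ := ‖padicRegulator Dh‖ with hb
  set c : ℝ := ‖(W.tamagawaProduct : ℚ_[p])‖ with hc
  set P : ℝ := ((p : ℝ)⁻¹) ^ r with hP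
  have ha_le : a ≤ 1 := by
    simpa [ha] using Padic.norm_int_le_one (p := p) (Nat.card (AddCommGroup.primaryComponent W.sha p) : ℤ)
  have hc_le : c ≤ 1 := by
    simpa [hc] using Padic.norm_int_le_one (p := p) (W.tamagawaProduct : ℤ)
  have ha0 : 0 ≤ a := norm_nonneg _
  have hb0 : 0 ≤ b := norm_nonneg _
  have hc0 : 0 ≤ c := norm_nonneg _
  have hP0 : 0 < P := pow_pos hp0 r
  rw [hrank] at hint
  have hb_le : b ≤ P := hint
  -- clause 3 in norms: `P = a * b * c`
  have hN := congrArg (fun x : ℚ_[p] ↦ ‖x‖) hu3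
  simp only [norm_mul, norm_pow, hrank, hcoeff, hlog, htor, hnU, heps, one_mul, mul_one,
    one_pow] at hN
  rw [← ha, ← hb, ← hc, ← hP] at hN
  -- hN : P = a * b * c ; each factor is at its ceiling
  have hbc : b * c ≤ P := by
    calc b * c ≤ P * 1 := mul_le_mul hb_le hc_le hc0 hP0.le
      _ = P := mul_one _
  have ha1 : a = 1 := by
    refine le_antisymm ha_le ?_
    by_contra hlt
    push Not at hlt
    have : a * b * c < P :=
      calc a * b * c = a * (b * c) := mul_assoc _ _ _
        _ ≤ a * P := mul_le_mul_of_nonneg_left hbc ha0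
        _ < 1 * P := mul_lt_mul_of_pos_right hlt hP0
        _ = P := one_mul _
    exact absurd hN (ne_of_gt this)
  have hc1 : c = 1 := by
    refine le_antisymm hc_le ?_
    by_contra hlt
    push Not at hlt
    have : a * b * c < P :=
      calc a * b * c = b * c := by rw [ha1, one_mul]
        _ ≤ P * c := mul_le_mul_of_nonneg_right hb_le hc0
        _ < P * 1 := mul_lt_mul_of_pos_left hlt hP0
        _ = P := mul_one _
    exact absurd hN (ne_of_gt this)
  have hRegEq : b = P := by
    have h := hN
    rw [ha1, hc1, one_mul, mul_one] at h
    exact h.symm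
  refine ⟨hrank, horder, hS, ?_, ?_, hRegEq⟩
  · apply primaryComponent_eq_bot_of_not_dvd_card
    intro hdvd
    have h := (Padic.norm_natCast_lt_one_iff (p := p)).mpr hdvd
    rw [← ha, ha1] at h
    exact lt_irrefl _ h
  · intro hdvd
    have h := (Padic.norm_natCast_lt_one_iff (p := p)).mpr hdvd
    rw [← hc, hc1] at h
    exact lt_irrefl _ h

/-- **(C) From the ANALYTIC `p`-adic `L`-function to the characteristic series** (modulo
`Schneider1985_order_charGenerator_odd` and Kato's divisibility `kato_divisibility W p` at `f`, clause
3 — the INTEGRAL divisibility `char X ∣ L_p` in `Λ` under "`ρ_{E,p^n}` surjective for every `n`"):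
if `r ≤ rank E(ℚ)` and the `T^r`-coefficient of `L_p(E,T) = L_p(f, α; T)` has norm `1` (for an
element of `Λ` vanishing to order `≥ r`: "`μ = 0 ∧ λ = r`", PARI's `ellpadiclambdamu`), then the
`T^r`-coefficient of `f_E` is a unit of `ℤ_p` — so (A)/(B) apply — and the cofactor is a unit:
`L_p = ι(f_E · h)` with `h ∈ Λˣ`, i.e. the main-conjecture EQUALITY `(L_p) = char X` holds for this
curve with no further input. Proof: `L_p = ι(h)·ι(f_E)` with `f_E ∈ T^r Λ` (clause 1:
`r ≤ rank ≤ ord f_E`), so `[T^r]L_p = f_E[r] · h(0)`, a product of two `p`-adic integers of norm `1`.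
[cite: Kato2004Asterisque, Thm. 17.4 (p. 273)] [cite: BalakrishnanMullerStein2015, Thm. 1.7] -/
theorem isUnit_coeff_of_norm_coeff_padicLFunction (h85 : Schneider1985_order_charGenerator_odd)
    (hp2 : p ≠ 2) (hgood : W.HasGoodReductionAtPrime p) (hord : ¬ (p : ℤ) ∣ W.frobeniusTrace p)
    {κ : ZpExtension ℚ p} {γ : Field.absoluteGaloisGroup ℚ}
    (hκ : κ.IsCyclotomic) (hγ : κ.IsTopGenerator γ) (hγ' : IsCyclotomicVariable p γ)
    {N : ℕ} [NeZero N] {f : CuspForm (CongruenceSubgroup.Gamma0 N) 2}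
    (hfN : ModularForms.IsNewformOf W f) (hK : kato_divisibility W p (κ := κ) (γ := γ) (f := f))
    (hsurj : ∀ n : ℕ, W.HasSurjectiveModNGaloisRep (p ^ n : ℕ))
    (D : W.SelmerDualData κ γ) [Module.Finite (IwasawaAlgebra p) D.X]
    {fE : IwasawaAlgebra p} (hf : D.charIdeal = Ideal.span {fE})
    {r : ℕ} (hr : r ≤ W.mordellWeilRank)
    (hL : ‖PowerSeries.coeff r (padicLFunction f (unitRoot W p : ℚ_[p]))‖ = 1)
    (Dh : PAdicHeightData W p) (hDh : Dh.IsCanonical) :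
    IsUnit (PowerSeries.coeff r fE) ∧
      ∃ h : IwasawaAlgebra p, IsUnit h ∧
        iwasawaToPowerSeries p (h * fE) = padicLFunction f (unitRoot W p : ℚ_[p]) := by
  obtain ⟨hX, -, h3⟩ := hK hp2 ⟨hgood, hord⟩ hκ hγ hγ' hfN D
  obtain ⟨g, hg, hιg⟩ := h3 hsurj
  rw [hf] at hg
  obtain ⟨h, rfl⟩ := Ideal.mem_span_singleton'.mp hg
  obtain ⟨hle, -, -⟩ := h85 W p hp2 hgood hord κ γ hκ hγ hγ' D hX fE hf Dh hDh
  have hrle : (r : ℕ∞) ≤ fE.order := le_trans (by exact_mod_cast hr) hle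
  -- the coefficients of `ι f_E` below `r` vanish: `ι f_E = T^r · q`
  have hlow : ∀ m : ℕ, m < r → PowerSeries.coeff m (iwasawaToPowerSeries p fE) = 0 := by
    intro m hm
    have h0 : PowerSeries.coeff m fE = 0 :=
      PowerSeries.coeff_of_lt_order m (lt_of_lt_of_le (by exact_mod_cast hm) hrle)
    rw [PowerSeries.coeff_map, h0, map_zero]
  obtain ⟨q, hq⟩ := PowerSeries.X_pow_dvd_iff.mpr hlow
  -- `[T^r] L_p = q(0) · h(0)` and `q(0) = ι(f_E[r])`
  have hqr : PowerSeries.coeff 0 q = ((PowerSeries.coeff r fE : ℤ_[p]) : ℚ_[p]) := by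
    have h1 := congrArg (PowerSeries.coeff r) hq
    rw [PowerSeries.coeff_X_pow_mul', if_pos le_rfl, Nat.sub_self, PowerSeries.coeff_map] at h1
    exact h1.symm
  have hLr : PowerSeries.coeff r (padicLFunction f (unitRoot W p : ℚ_[p])) =
      ((PowerSeries.coeff r fE : ℤ_[p]) : ℚ_[p]) * ((PowerSeries.coeff 0 h : ℤ_[p]) : ℚ_[p]) := by
    rw [← hιg, map_mul, hq, show iwasawaToPowerSeries p h * (PowerSeries.X ^ r * q) =
      PowerSeries.X ^ r * (q * iwasawaToPowerSeries p h) by ring, PowerSeries.coeff_X_pow_mul',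
      if_pos le_rfl, Nat.sub_self, PowerSeries.coeff_zero_eq_constantCoeff, map_mul,
      ← PowerSeries.coeff_zero_eq_constantCoeff_apply, ← PowerSeries.coeff_zero_eq_constantCoeff_apply,
      hqr, PowerSeries.coeff_map]
    rfl
  -- two `p`-adic integers whose product has norm `1` are units
  have ha : ‖((PowerSeries.coeff r fE : ℤ_[p]) : ℚ_[p])‖ ≤ 1 := by
    rw [PadicInt.padic_norm_e_of_padicInt]; exact PadicInt.norm_le_one _
  have hb : ‖((PowerSeries.coeff 0 h : ℤ_[p]) : ℚ_[p])‖ ≤ 1 := by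
    rw [PadicInt.padic_norm_e_of_padicInt]; exact PadicInt.norm_le_one _
  rw [hLr, norm_mul] at hL
  have ha1 : ‖((PowerSeries.coeff r fE : ℤ_[p]) : ℚ_[p])‖ = 1 := by
    refine le_antisymm ha ?_
    by_contra hlt
    push Not at hlt
    have : ‖((PowerSeries.coeff r fE : ℤ_[p]) : ℚ_[p])‖ *
        ‖((PowerSeries.coeff 0 h : ℤ_[p]) : ℚ_[p])‖ < 1 := by
      calc _ ≤ ‖((PowerSeries.coeff r fE : ℤ_[p]) : ℚ_[p])‖ * 1 :=
            mul_le_mul_of_nonneg_left hb (norm_nonneg _)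
        _ < 1 * 1 := by rw [mul_one, mul_one]; exact hlt
        _ = 1 := mul_one _
    exact absurd hL (ne_of_lt this)
  have hb1 : ‖((PowerSeries.coeff 0 h : ℤ_[p]) : ℚ_[p])‖ = 1 := by
    rw [ha1, one_mul] at hL; exact hL
  have huf : IsUnit (PowerSeries.coeff r fE) :=
    PadicInt.isUnit_iff.mpr (by rw [← PadicInt.padic_norm_e_of_padicInt]; exact ha1)
  have huh0 : IsUnit (PowerSeries.coeff 0 h) :=
    PadicInt.isUnit_iff.mpr (by rw [← PadicInt.padic_norm_e_of_padicInt]; exact hb1)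
  have huh : IsUnit h := by
    rw [PowerSeries.isUnit_iff_constantCoeff, ← PowerSeries.coeff_zero_eq_constantCoeff_apply]
    exact huh0
  exact ⟨huf, h, huh, hιg⟩

/-- The coefficientwise embedding `ι : ℤ_p⟦T⟧ ↪ ℚ_p⟦T⟧` preserves the order of vanishing at
`T = 0` (injectivity of `ℤ_p → ℚ_p` on coefficients). [folklore] -/
private theorem order_iwasawaToPowerSeries_aux (g : IwasawaAlgebra p) :
    (iwasawaToPowerSeries p g).order = g.order := by
  refine le_antisymm ?_ (PowerSeries.le_order_map _)
  refine PowerSeries.le_order _ _ fun i hi ↦ ?_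
  have h := PowerSeries.coeff_of_lt_order i hi
  rw [PowerSeries.coeff_map] at h
  exact (Subtype.coe_injective : Function.Injective (algebraMap ℤ_[p] ℚ_[p]))
    (h.trans (map_zero (algebraMap ℤ_[p] ℚ_[p])).symm)

/-- **(D) The λ-door at a NON-ANOMALOUS prime, end to end, per member** (modulo the named facts
`Schneider1985_order_charGenerator_odd` and `kato_divisibility W p`; no main-conjecture equality, no
Skinner–Urban): `E/ℚ` with globally minimal `W`, `p` odd good ordinary with `p ∤ #Ẽ(𝔽_p)`,
`ρ_{E,p^n}` surjective for every `n`, `p ∤ #E(ℚ)_tors`, the canonical `p`-adic regulator integral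
(`‖Reg_p‖ ≤ p^{-rank}`, Mazur–Tate 1983 §3.3), `r ≤ rank E(ℚ)` (e.g. `r` independent points), and
the ANALYTIC input "`[T^r] L_p(E,T)` has norm `1`" (PARI: `μ_p = 0 ∧ λ_p = r`). Then
`rank E(ℚ) = r = ord_{T=0} L_p(E,T) = ord_{T=0} f_E`, Schneider's conjecture holds at `p`,
`Ш(E)[p^∞] = 0`, `p ∤ ∏ c_ℓ`, `‖Reg_p‖ = p^{-r}`, and `(L_p) = char X(E/ℚ_∞)` (unit cofactor).
This is the member-wise kernel of the cell's door D-λ(p) (memo `HOME/bsd-rank2-eng/data/f2door/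
LAMBDA5.md`: the hypotheses hold and the door fires on 409/409 + 388/388 members of `F₂` at
`p = 5, 7` with `N ≤ 2·10⁴`); the family-level input — the analytic unit coefficient on a
positive-density subfamily — is NOT supplied here. [cite: Kato2004Asterisque, Thm. 17.4 (p. 273)]
[cite: BalakrishnanMullerStein2015, Thm. 1.7] [cite: MazurTate1983Biext, §3.3] -/
theorem lambdaDoor_of_norm_coeff_padicLFunction (h85 : Schneider1985_order_charGenerator_odd)
    (hp2 : p ≠ 2) (hgood : W.HasGoodReductionAtPrime p) (hord : ¬ (p : ℤ) ∣ W.frobeniusTrace p)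
    {κ : ZpExtension ℚ p} {γ : Field.absoluteGaloisGroup ℚ}
    (hκ : κ.IsCyclotomic) (hγ : κ.IsTopGenerator γ) (hγ' : IsCyclotomicVariable p γ)
    {N : ℕ} [NeZero N] {f : CuspForm (CongruenceSubgroup.Gamma0 N) 2}
    (hfN : ModularForms.IsNewformOf W f) (hK : kato_divisibility W p (κ := κ) (γ := γ) (f := f))
    (hsurj : ∀ n : ℕ, W.HasSurjectiveModNGaloisRep (p ^ n : ℕ))
    (D : W.SelmerDualData κ γ) [Module.Finite (IwasawaAlgebra p) D.X]
    {fE : IwasawaAlgebra p} (hf : D.charIdeal = Ideal.span {fE})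
    {r : ℕ} (hr : r ≤ W.mordellWeilRank)
    (hL : ‖PowerSeries.coeff r (padicLFunction f (unitRoot W p : ℚ_[p]))‖ = 1)
    (Dh : PAdicHeightData W p) (hDh : Dh.IsCanonical)
    (hna : ¬ p ∣ W.reductionPointCount p) (htors : ¬ p ∣ W.torsionOrder)
    (hint : ‖padicRegulator Dh‖ ≤ ((p : ℝ)⁻¹) ^ W.mordellWeilRank) :
    W.mordellWeilRank = r ∧ fE.order = r ∧
      (padicLFunction f (unitRoot W p : ℚ_[p])).order = r ∧ SchneiderConjecture Dh ∧
      AddCommGroup.primaryComponent W.sha p = ⊥ ∧ ¬ p ∣ W.tamagawaProduct ∧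
      ‖padicRegulator Dh‖ = ((p : ℝ)⁻¹) ^ r ∧
      ∃ h : IwasawaAlgebra p, IsUnit h ∧
        iwasawaToPowerSeries p (h * fE) = padicLFunction f (unitRoot W p : ℚ_[p]) := by
  obtain ⟨hu, h, huh, hιg⟩ := isUnit_coeff_of_norm_coeff_padicLFunction h85 hp2 hgood hord hκ hγ
    hγ' hfN hK hsurj D hf hr hL Dh hDh
  obtain ⟨hX, -, -⟩ := hK hp2 ⟨hgood, hord⟩ hκ hγ hγ' hfN D
  obtain ⟨hrank, horder, hS, hsha, htam, hreg⟩ := sha_eq_bot_of_isUnit_coeff h85 hp2 hgood hord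
    hκ hγ hγ' D hX hf hr hu Dh hDh hna htors hint
  refine ⟨hrank, horder, ?_, hS, hsha, htam, hreg, h, huh, hιg⟩
  rw [← hιg, order_iwasawaToPowerSeries_aux, PowerSeries.order_mul,
    PowerSeries.order_zero_of_unit huh, zero_add, horder]

/-- **(E) The λ-door at a prime `p ≥ 5`, with the image hypothesis in CONGRUENCE-CHECKABLE form**:
as (D), but Kato's integral-divisibility hypothesis "`ρ_{E,p^n}` surjective for every `n`" is
replaced by `E` SEMISTABLE and `E[p]` IRREDUCIBLE — Serre 1972 Prop. 21 i) / Edixhoven 1997 (tree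
theorem `hasSurjectiveModNGaloisRep_of_hasIrreducibleModPGaloisRep_of_isSemistable`: semistable +
irreducible ⇒ `ρ̄_{E,p}` onto) and Serre's lifting lemma (tree theorem
`serre_hasSurjectiveModNGaloisRep_pow_holds`: `p ≥ 5`, onto mod `p` ⇒ onto mod `p^n`). Irreducibility
mod `p` is certified family-wide by one Frobenius class (as for `Φ₀` at `p = 3`,
`Theorems/CountingDoorF2AtThreeDoorFamily.lean`), so every hypothesis of the door except the
analytic unit coefficient and the height-integrality bound is a finite congruence / semistability
condition on the member. [cite: Serre1972, §5.4 Prop. 21 i)] [cite: SerreAbelianLadic1968, Ch. IV §3.4, Lemma 3]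
[cite: Kato2004Asterisque, Thm. 17.4 (p. 273)] [cite: BalakrishnanMullerStein2015, Thm. 1.7] -/
theorem lambdaDoor_of_norm_coeff_padicLFunction_of_irreducible
    (h85 : Schneider1985_order_charGenerator_odd)
    (hp5 : 5 ≤ p) (hgood : W.HasGoodReductionAtPrime p) (hord : ¬ (p : ℤ) ∣ W.frobeniusTrace p)
    {κ : ZpExtension ℚ p} {γ : Field.absoluteGaloisGroup ℚ}
    (hκ : κ.IsCyclotomic) (hγ : κ.IsTopGenerator γ) (hγ' : IsCyclotomicVariable p γ)
    {N : ℕ} [NeZero N] {f : CuspForm (CongruenceSubgroup.Gamma0 N) 2}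
    (hfN : ModularForms.IsNewformOf W f) (hK : kato_divisibility W p (κ := κ) (γ := γ) (f := f))
    (hsemi : W.IsSemistable (NumberField.RingOfIntegers ℚ)) (hirr : W.HasIrreducibleModPGaloisRep p)
    (D : W.SelmerDualData κ γ) [Module.Finite (IwasawaAlgebra p) D.X]
    {fE : IwasawaAlgebra p} (hf : D.charIdeal = Ideal.span {fE})
    {r : ℕ} (hr : r ≤ W.mordellWeilRank)
    (hL : ‖PowerSeries.coeff r (padicLFunction f (unitRoot W p : ℚ_[p]))‖ = 1)
    (Dh : PAdicHeightData W p) (hDh : Dh.IsCanonical)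
    (hna : ¬ p ∣ W.reductionPointCount p) (htors : ¬ p ∣ W.torsionOrder)
    (hint : ‖padicRegulator Dh‖ ≤ ((p : ℝ)⁻¹) ^ W.mordellWeilRank) :
    W.mordellWeilRank = r ∧ fE.order = r ∧
      (padicLFunction f (unitRoot W p : ℚ_[p])).order = r ∧ SchneiderConjecture Dh ∧
      AddCommGroup.primaryComponent W.sha p = ⊥ ∧ ¬ p ∣ W.tamagawaProduct ∧
      ‖padicRegulator Dh‖ = ((p : ℝ)⁻¹) ^ r ∧
      ∃ h : IwasawaAlgebra p, IsUnit h ∧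
        iwasawaToPowerSeries p (h * fE) = padicLFunction f (unitRoot W p : ℚ_[p]) := by
  have hp2 : p ≠ 2 := by omega
  have hsurj1 : W.HasSurjectiveModNGaloisRep p :=
    hasSurjectiveModNGaloisRep_of_hasIrreducibleModPGaloisRep_of_isSemistable W hsemi p hirr
  have hsurj : ∀ n : ℕ, W.HasSurjectiveModNGaloisRep (p ^ n : ℕ) :=
    serre_hasSurjectiveModNGaloisRep_pow_holds W p hp5 hsurj1
  exact lambdaDoor_of_norm_coeff_padicLFunction h85 hp2 hgood hord hκ hγ hγ' hfN hK hsurj D hf hr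
    hL Dh hDh hna htors hint

end Summit.BirchSwinnertonDyer.BirchSwinnertonDyer.Theorems

end
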